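import Summits.BirchSwinnertonDyer.BirchSwinnertonDyer.Theorems.AdditiveBranchIMCGordTwoRankOneHeegnerKolyvaginIstarDoorsSubgroup
import Summits.BirchSwinnertonDyer.Rank1Residual.GaloisImage.FrobeniusOrderWitness
import Summits.BirchSwinnertonDyer.Rank1Residual.Supersingular.CountPointsFast
import Summits.BirchSwinnertonDyer.Rank1Residual.Supersingular.IntModelMinimalityKrausTwoMore
import Summits.BirchSwinnertonDyer.Rank1Residual.Supersingular.RankOneRem13NoCertificate
import Summits.BirchSwinnertonDyer.Rank1Residual.Additive.X4ThreeResCertKernel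
import Summits.BirchSwinnertonDyer.Rank1Residual.Additive.TypeGThree
import Summits.BirchSwinnertonDyer.Rank1Residual.Additive.SubGordThree
import Summits.BirchSwinnertonDyer.Rank1Residual.Additive.SemistableTwistAnalytic
import Summits.BirchSwinnertonDyer.Rank1Residual.O5.GssSplitThree
import Summits.BirchSwinnertonDyer.Rank1Residual.X11b.CertificateCheckBridge
import HarnessLib

/-!
# Route `AdditiveBranchIMC` (rung K1), crux `GordTwoRankOne` (item 19358) — the Heegner–Kolyvagin road, Part 24a:
# KERNEL RECORDS `BSD(E,3)` on the rank-ONE (G) ∧ ss (`e = 2`) residue rows at `p = 3` with `#Ш_an = 9` — 182853c1 (d_K = −35) · 228897c1 (d_K = −23)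
# (cell `bsd-addord`, second prover lane `bsd-addord-k1-c3x`, gen 9; planner g26 seat ask STATUS l.1943 / REQUESTS l.22159; `--supports` only)

HONEST FRAMING. THEOREMS ONLY (no definition, no named fact, no `sorry`); PER PAIR — NOT a class theorem; nothing is booked by this
file (booking is referee A's / A2's on the planner's offer); crux 19358 stays OPEN at class level; the rows are cell `bsd-potss`'s at
class level (B4 Gss2 r1); BSD is not proved by any of this. Each record instantiates gen 6's door
`HeegnerKolyvagin.bsdp_three_rankOne_subGss_of_card_addSubgroup_selmerThree_of_twistShaAnUnit` (Part 23d, p584506,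
`…HeegnerKolyvaginIstarDoorsSubgroup.lean`): UPPER(E,3) = Kolyvagin 1990 Thm. A at the Manin-good Heegner datum of an additive prime of
Kodaira type `Iₙ*` (Mazur–Stevens; cite-only Manin facts hMz hAU hC2) + Gross–Zagier + the rank-zero Heegner twist's free lower half
(`ord₃ #Ш_an(E^{d_K}) = 0`); LOWER(E,3) = x11b's `pow_dvd_shaOrder_of_card_addSubgroup_selmerGroup` from an EXHIBITED subgroup
`S ≤ Sel^(3)(E/ℚ)` of order `27` (GZK: rank `1`; `ρ̄₃` onto: `E(ℚ)[3] = 0`) — no Cassels–Tate, no class group, no GRH.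

IN THE KERNEL per record (shape of k1-c2x's `…GordTwoRankZeroDesc3Records*`): `Δ ≠ 0` and global minimality (Kraus, factorisations
checked) of Cremona's model `E`, of the minimal model `V` of `E^{(−3)}` and of the minimal model `Wd` of the Heegner twist `E^{(d_K)}`;
`Addv W 3` (`3 ∣ Δ`, `3 ∣ c₄`); the census cell `SubGss W 3` ((G) ∧ ss: the explicit isomorphism `C • V^{(−3)} = E`, `V` GOOD at `3`
with `3 ∣ a₃(V)` by its `𝔽₃`-point count, then `typeG_three_iff_good_twist` / `subGord_three_of_typeG_of_addv` /
`O5.subGss_three_iff_subGord_and_goodSS_twist`); `ρ̄_{E,3}` ONTO (Frobenius witnesses: irreducible characteristic polynomial mod `3` at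
`ℓ₁`; `ℓ₂ ≡ 1`, `a_{ℓ₂} ≡ 2 (mod 3)`, `9 ∤ #Ẽ(𝔽_{ℓ₂})`); the twist identity `Cd • E^{(d_K)} = Wd` (with `d_K` substituted from `hdK`).
DISPLAYED binders per record: the published facts {hGZ, hKo, hB, hGZK, hmod, hnf, hMz, hAU, hC2}; Cremona's `r_an = 1` (`hr`),
`3 ∤ ∏ c_ℓ` (`htam`), `#Ш_an = 9` (`hq`/`hv`: `ord₃ ≤ 2`); the Heegner field `K` (`hK`, `hdK : d_K = …`, `hHN`: every prime of `N`
splits in `K` — checked, kit j294966); the twist datum `L(E^{(d_K)},1) ≠ 0` (`hLt`) and `#Ш_an(Wd) = qd` with `ord₃ qd ≤ 0`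
(`hqd`/`hvd`) — VALUES BY TWO ENGINES: engine 1 = PARI `lfun`/`ellL1`/`ellbsd` (lane-B kit j292847/j293586, table
`HOME/k1-c3x/desc3-g6/GSS2-R1-P3-TABLE-v2.tsv` c82dc6843d110ac4), engine 2 = PARI-FREE (lane-B kit **j294995**, bundle
`HOME/k1-c3x/e2twist-g9/`: bsd-jet eng-2's `e2lib.py` 6701e05d + `tate_stdlib.py` ed9e5fd9 VERBATIM — BGZ series from proved point
counts, AGM period with `j` self-check, own Tate algorithm, torsion by gcd/exhibition, numerical functional equation for `ε = +1`):
7/7 TWO-ENGINE-AGREE (`L` to `< 2·10⁻¹⁵` relative, `#Ш_an(Wd)` integral squares `1, 1, 4, 1, 4, 4, 100`, `N`, `∏c`, torsion equal);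
and the certificate line `S ≤ Sel^(3)(E/ℚ)`, `#S = 27` (`hS`/`hcardS`) — LB3SUB two-engine GRH-free (kit j293463 E1 x11b GEN-11
`desc3lib.gp` e6c495dc + verify3 + indep3; kit j293581 E2 x10b `desc3full_e2.py` dfa51aff LOWERBOUND, same `𝔽₃`-subspace), bundle
`HOME/k1-c3x/desc3-g6/`. The conductors `N(Wd) = N·d_K²` exceed Cremona's range: the desk's word on a computed `#Ш_an(E^{d_K})` is the
one pricing question (REQUESTS l.22159).

References: [JetchevSkinnerWan2017] §7.4.1–7.4.3; [McCallumLMS1991] §1; [KolyvaginEulerSystems1990] Thm. A; [SilvermanAEC2009]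
VII.1 Rem. 1.1, VII.5.1, X.4.2(a); [Kraus1989]; [Serre1972] §2; [IrelandRosen1990] §5, §8; [SchaeferStoll2004] §1, §5; [Delbourgo1998]
§1.5 (G); [Mazur1977] III.§5; [Miller2011LMS] Def. 1.1; [Cremona2006] Table 1.
-/

set_option autoImplicit false
set_option linter.dupNamespace false
noncomputable section
open scoped Classical NumberField
open WeierstrassCurve NumberField IsDedekindDomain IsDedekindDomain.HeightOneSpectrum Rat.HeightOneSpectrum Field
  Literature.NumberTheory.DiophantineGeometry Literature.NumberTheory.EllipticCurves
  Literature.NumberTheory.EllipticCurves.ModularForms Literature.NumberTheory.EllipticCurves.Rank1Residual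
  Literature.NumberTheory.EllipticCurves.Rank1Residual.Typed Literature.NumberTheory.Automorphic
  Literature.NumberTheory.EllipticCurves.Rank1Residual.X11RankOneCertificates
  Literature.NumberTheory.GaloisRepresentations
  Summit.BirchSwinnertonDyer.BirchSwinnertonDyer.Rank1Residual.IntModel
  Summit.BirchSwinnertonDyer.Rank1Residual Summit.BirchSwinnertonDyer.Rank1Residual.Additive
  Summit.BirchSwinnertonDyer.Rank1Residual.X11b Summit.BirchSwinnertonDyer.Rank1Residual.GaloisImage
  Summit.BirchSwinnertonDyer.Rank1Residual.Supersingular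
  Summit.BirchSwinnertonDyer.BirchSwinnertonDyer.Theses.AdditiveKolyvaginRoad
  Summit.BirchSwinnertonDyer.BirchSwinnertonDyer.Theorems.AdditiveKolyvaginKernel
  Summit.BirchSwinnertonDyer.BirchSwinnertonDyer.Theorems

namespace Summit.BirchSwinnertonDyer.BirchSwinnertonDyer.Theorems.AdditiveBranchIMCGordTwoRankOne.HeegnerKolyvagin

/-! ### `182853c1` — `N = 182853 = 3²·11·1847`; Cremona: `r_an = 1`, `#Ш_an = 9`, `#E(ℚ)_tors = 1`, `∏ c_ℓ = 2`;
(G) ∧ ss at `3` (`e = 2`, `a₃` of the `(−3)`-twist `= 3`); Heegner field `ℚ(√-35)` -/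

/-- `[0, 0, 1, -522, -9187]` (Cremona's minimal model of `182853c1`) is an elliptic curve: `Δ = −3⁶·11·1847² ≠ 0`. [cite: Cremona2006, Table 1 (Cremona label 182853c1)] -/
theorem isElliptic_g182853c1 : (⟨0, 0, 1, -522, -9187⟩ : WeierstrassCurve ℚ).IsElliptic :=
  isElliptic_of_discOf_ne_zero 0 0 1 (-522) (-9187) (by decide +kernel)

/-- `[0, 0, 1, -522, -9187]` (`182853c1`) is globally minimal: complete factorisation `|Δ| = 3⁶·11·1847²` kernel-checked and Kraus'
criterion prime by prime (`isGloballyMinimal_of_krausCriterion₃_factored`). [cite: SilvermanAEC2009, VII.1 Remark 1.1]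
[cite: Kraus1989, Prop. 1 and Prop. 2] [cite: Cremona2006, Table 1 (Cremona label 182853c1)] -/
theorem isGloballyMinimal_g182853c1 : (⟨0, 0, 1, -522, -9187⟩ : WeierstrassCurve ℚ).IsGloballyMinimal :=
  isGloballyMinimal_of_krausCriterion₃_factored 0 0 1 (-522) (-9187)
    [(3, 6), (11, 1), (1847, 2)] (by decide +kernel)
    (by intro qe hqe; simp only [List.mem_cons, List.not_mem_nil, or_false] at hqe
        rcases hqe with rfl | rfl | rfl <;> norm_num)
    (by set_option synthInstance.maxSize 2000 in decide +kernel)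

/-- `[0, 0, 1, -58, 340]` (the minimal model `V` of the `(−3)`-twist of `182853c1`, conductor `20317`) is an elliptic curve: `Δ = −11·1847² ≠ 0`. [cite: Cremona2006, Table 1 (Cremona label 182853c1)] -/
theorem isElliptic_gV182853c1 : (⟨0, 0, 1, -58, 340⟩ : WeierstrassCurve ℚ).IsElliptic :=
  isElliptic_of_discOf_ne_zero 0 0 1 (-58) 340 (by decide +kernel)

/-- `[0, 0, 1, -58, 340]` (`V = 182853c1^{(−3)}`) is globally minimal: complete factorisation `|Δ| = 11·1847²` kernel-checked and Kraus'
criterion prime by prime (`isGloballyMinimal_of_krausCriterion₃_factored`). [cite: SilvermanAEC2009, VII.1 Remark 1.1]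
[cite: Kraus1989, Prop. 1 and Prop. 2] [cite: Cremona2006, Table 1 (Cremona label 182853c1)] -/
theorem isGloballyMinimal_gV182853c1 : (⟨0, 0, 1, -58, 340⟩ : WeierstrassCurve ℚ).IsGloballyMinimal :=
  isGloballyMinimal_of_krausCriterion₃_factored 0 0 1 (-58) 340
    [(11, 1), (1847, 2)] (by decide +kernel)
    (by intro qe hqe; simp only [List.mem_cons, List.not_mem_nil, or_false] at hqe
        rcases hqe with rfl | rfl <;> norm_num)
    (by set_option synthInstance.maxSize 2000 in decide +kernel)

/-- `[0, 0, 1, -639450, 393881906]` (the minimal model `Wd` of the Heegner twist `182853c1^{(-35)}`, conductor `223994925 = 3²·5²·7²·11·1847`) is an elliptic curve: `|Δ| = 3⁶·5⁶·7⁶·11·1847² ≠ 0`. [cite: Cremona2006, Table 1 (Cremona label 182853c1)] -/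
theorem isElliptic_gWd182853c1 : (⟨0, 0, 1, -639450, 393881906⟩ : WeierstrassCurve ℚ).IsElliptic :=
  isElliptic_of_discOf_ne_zero 0 0 1 (-639450) 393881906 (by decide +kernel)

/-- `[0, 0, 1, -639450, 393881906]` (`Wd = 182853c1^{(-35)}`) is globally minimal: complete factorisation `|Δ| = 3⁶·5⁶·7⁶·11·1847²` kernel-checked and Kraus'
criterion prime by prime (`isGloballyMinimal_of_krausCriterion₃_factored`). [cite: SilvermanAEC2009, VII.1 Remark 1.1]
[cite: Kraus1989, Prop. 1 and Prop. 2] [cite: Cremona2006, Table 1 (Cremona label 182853c1)] -/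
theorem isGloballyMinimal_gWd182853c1 : (⟨0, 0, 1, -639450, 393881906⟩ : WeierstrassCurve ℚ).IsGloballyMinimal :=
  isGloballyMinimal_of_krausCriterion₃_factored 0 0 1 (-639450) 393881906
    [(3, 6), (5, 6), (7, 6), (11, 1), (1847, 2)] (by decide +kernel)
    (by intro qe hqe; simp only [List.mem_cons, List.not_mem_nil, or_false] at hqe
        rcases hqe with rfl | rfl | rfl | rfl | rfl <;> norm_num)
    (by set_option synthInstance.maxSize 2000 in decide +kernel)

/-- **`ρ̄_{E,3}` ONTO for `E = 182853c1`** (kernel): irreducible by `ℓ₁ = 5` (`#Ẽ(𝔽_{5}) = 5`, `a = 1`: `X² − aX + ℓ₁` has no root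
mod `3`); an element of order `3` by `ℓ₂ = 19` (`ℓ₂ ≡ 1`, `#Ẽ(𝔽_{19}) = 24`, `a = -4 ≡ 2 (mod 3)`, `9 ∤ 24`) —
`hasSurjectiveModNGaloisRep_of_intModel_of_irr_of_order`; point counts by `decide +kernel`.
[cite: Serre1972, §2.4 Prop. 15, §2.8 Prop. 19] [cite: IrelandRosen1990, Prop. 5.1.2 and §8.1] [cite: Cremona2006, Table 1 (Cremona label 182853c1)] -/
theorem surj_g182853c1_3 : (⟨0, 0, 1, -522, -9187⟩ : WeierstrassCurve ℚ).HasSurjectiveModNGaloisRep 3 := by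
  haveI := isElliptic_g182853c1
  haveI := isGloballyMinimal_g182853c1
  haveI : Fact (Nat.Prime 5) := ⟨by norm_num⟩
  haveI : Fact (Nat.Prime 19) := ⟨by norm_num⟩
  have hI : integralModelInt (⟨0, 0, 1, -522, -9187⟩ : WeierstrassCurve ℚ) = (⟨0, 0, 1, -522, -9187⟩ : WeierstrassCurve ℤ) :=
    integralModelInt_eq_of_map_eq _ (map_mk_int 0 0 1 (-522) (-9187))
  have hc₁ : Nat.card ((((⟨0, 0, 1, -522, -9187⟩ : WeierstrassCurve ℤ)).map (Int.castRingHom (ZMod 5))).toAffine.Point) = 5 := by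
    have h := natCard_point_eq_countPoints 0 0 1 (-522) (-9187) 5 (by norm_num) (by decide +kernel)
    have h' : countPoints [0, 0, 1, -522, -9187] 5 = 5 := countPoints_eq_of_fast (by decide +kernel)
    exact_mod_cast h.trans h'
  have hc₂ : Nat.card ((((⟨0, 0, 1, -522, -9187⟩ : WeierstrassCurve ℤ)).map (Int.castRingHom (ZMod 19))).toAffine.Point) = 24 := by
    have h := natCard_point_eq_countPoints 0 0 1 (-522) (-9187) 19 (by norm_num) (by decide +kernel)
    have h' : countPoints [0, 0, 1, -522, -9187] 19 = 24 := countPoints_eq_of_fast (by decide +kernel)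
    exact_mod_cast h.trans h'
  exact hasSurjectiveModNGaloisRep_of_intModel_of_irr_of_order hI 3 5 19 (by norm_num) (by norm_num) (by decide +kernel)
    (by decide +kernel) hc₁ hc₂ (by decide) (by decide) (by decide) (by decide)

/-- **`182853c1` is ADDITIVE at `3` and lies on the census cell (G) ∧ ss** (Kodaira `I₀*`, `e = 2`, the `(−3)`-twist GOOD
SUPERSINGULAR), IN THE KERNEL: `3 ∣ Δ`, `3 ∣ c₄` on the minimal model (`Additive.addv_of_intModel`); the explicit isomorphism
`C • V^{(−3)} = E`, `[u, r, s, t] = [1, 0, 0, 1/2]`, with `V = [0, 0, 1, -58, 340]` globally minimal, `3 ∤ Δ(V)`, `#Ṽ(𝔽₃) = 1` (`a₃(V) = 3`,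
`3 ∣ a₃`: `Supersingular.goodSS_of_intModel`), whence `TypeG W 3` (`typeG_three_iff_good_twist`), `SubGord W 3`
(`subGord_three_of_typeG_of_addv`) and `SubGss W 3` (`O5.subGss_three_iff_subGord_and_goodSS_twist`).
[cite: SilvermanAEC2009, VII.5 Prop. 5.1 (a), (c)] [cite: Delbourgo1998, §1.5 (G)] [cite: Cremona2006, Table 1 (Cremona label 182853c1)] -/
theorem subGss_g182853c1_3 :
    haveI := isElliptic_g182853c1; haveI := isGloballyMinimal_g182853c1
    Addv (⟨0, 0, 1, -522, -9187⟩ : WeierstrassCurve ℚ) 3 ∧ SubGss (⟨0, 0, 1, -522, -9187⟩ : WeierstrassCurve ℚ) 3 := by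
  haveI := isElliptic_g182853c1
  haveI := isGloballyMinimal_g182853c1
  haveI := isElliptic_gV182853c1
  haveI := isGloballyMinimal_gV182853c1
  have hIW : integralModelInt (⟨0, 0, 1, -522, -9187⟩ : WeierstrassCurve ℚ) = (⟨0, 0, 1, -522, -9187⟩ : WeierstrassCurve ℤ) :=
    integralModelInt_eq_of_map_eq _ (map_mk_int 0 0 1 (-522) (-9187))
  have hadd : Addv (⟨0, 0, 1, -522, -9187⟩ : WeierstrassCurve ℚ) 3 := Additive.addv_of_intModel hIW 3 (by decide +kernel) (by decide +kernel)
  have hIV : integralModelInt (⟨0, 0, 1, -58, 340⟩ : WeierstrassCurve ℚ) = (⟨0, 0, 1, -58, 340⟩ : WeierstrassCurve ℤ) :=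
    integralModelInt_eq_of_map_eq _ (map_mk_int 0 0 1 (-58) 340)
  have hcV : Nat.card ((((⟨0, 0, 1, -58, 340⟩ : WeierstrassCurve ℤ)).map (Int.castRingHom (ZMod 3))).toAffine.Point) = 1 := by
    have h := natCard_point_eq_countPoints 0 0 1 (-58) 340 3 (by norm_num) (by decide +kernel)
    have h' : countPoints [0, 0, 1, -58, 340] 3 = 1 := countPoints_eq_of_fast (by decide +kernel)
    exact_mod_cast h.trans h'
  have hgood : GoodSS (⟨0, 0, 1, -58, 340⟩ : WeierstrassCurve ℚ) 3 := Supersingular.goodSS_of_intModel 3 hIV (by decide +kernel) hcV (by decide)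
  have hVW : (⟨1, (0 : ℚ), (0 : ℚ), ((1:ℚ)/2)⟩ : VariableChange ℚ) • (⟨0, 0, 1, -58, 340⟩ : WeierstrassCurve ℚ).quadraticTwist (-3) = (⟨0, 0, 1, -522, -9187⟩ : WeierstrassCurve ℚ) := by
    ext <;> simp [WeierstrassCurve.variableChange_a₁, WeierstrassCurve.variableChange_a₂,
      WeierstrassCurve.variableChange_a₃, WeierstrassCurve.variableChange_a₄, WeierstrassCurve.variableChange_a₆,
      WeierstrassCurve.quadraticTwist, WeierstrassCurve.b₂, WeierstrassCurve.b₄, WeierstrassCurve.b₆] <;> norm_num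
  obtain ⟨C, hC⟩ := exists_variableChange_quadraticTwist_symm (⟨0, 0, 1, -522, -9187⟩ : WeierstrassCurve ℚ) (⟨0, 0, 1, -58, 340⟩ : WeierstrassCurve ℚ) (d := (-3 : ℚ)) (by norm_num) ⟨_, hVW⟩
  have hC' : C • (⟨0, 0, 1, -522, -9187⟩ : WeierstrassCurve ℚ).quadraticTwist ((-1 : ℚ) ^ ((3 : ℕ) / 2) * (3 : ℕ)) = (⟨0, 0, 1, -58, 340⟩ : WeierstrassCurve ℚ) := by
    rw [O5.pstar_three]; exact hC
  have hG : TypeG (⟨0, 0, 1, -522, -9187⟩ : WeierstrassCurve ℚ) 3 := (typeG_three_iff_good_twist _ hadd _ C hC').mpr hgood.1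
  exact ⟨hadd, (O5.subGss_three_iff_subGord_and_goodSS_twist _ hadd _ C hC).mpr
    ⟨subGord_three_of_typeG_of_addv _ hG hadd, hgood⟩⟩

/-- **`BSD(E,3)` for `E = 182853c1`** (`N = 182853 = 3²·11·1847`; (G) ∧ ss at `3`, `e = 2`; Cremona: `r_an = 1` (generator `(97, 923)`),
`#Ш_an = 9`, `#E(ℚ)_tors = 1`, `∏ c_ℓ = 2`, `3 ∤ ∏ c_ℓ`), door `bsdp_three_rankOne_subGss_of_card_addSubgroup_selmerThree_of_twistShaAnUnit`
(Part 23d, p584506): UPPER = Kolyvagin at the Manin-good Heegner datum of the type-`I₀*` prime `3` over `K = ℚ(√-35)` + Gross–Zagier +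
the rank-zero twist's free lower half; LOWER = the exhibited subgroup `S ≤ Sel^(3)(E/ℚ)`, `#S = 27` (no Cassels–Tate, no class group).
IN THE KERNEL: `Δ ≠ 0` and global minimality of `E`, of `V = E^{(−3)}` and of `Wd = E^{(-35)}` (Kraus), `Addv W 3 ∧ SubGss W 3`
(`subGss_g182853c1_3`), `ρ̄_{E,3}` ONTO (`surj_g182853c1_3`), the twist identity `Cd • E^{(-35)} = Wd`, `[u, r, s, t] = [1, 0, 0, 1/2]`, with
`Wd = [0, 0, 1, -639450, 393881906]` (`N(Wd) = 223994925 = 3²·5²·7²·11·1847`). DISPLAYED binders: the PUBLISHED facts hGZ hKo hB hGZK hmod hnf (+ cite-only hMz hAU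
hC2); Cremona's `r_an = 1` (`hr`), `3 ∤ ∏ c_ℓ = 2` (`htam`), `#Ш_an = q`, `ord₃ q ≤ 2` (`hq`/`hv`); the Heegner field `K`,
`d_K = -35` (`hK`/`hdK`; every prime of `N` splits in `K`: kit j294966; other unit fields `d_K ∈ {-35, -68, -83, -131, -239, -248, -371, -431}`, kit j293586) with `hHN`;
the twist datum `L(E^{(-35)},1) ≠ 0` (`hLt`) and `#Ш_an(Wd) = qd`, `ord₃ qd ≤ 0` (`hqd`/`hvd`) — EVIDENCE, TWO ENGINES: engine 1 PARI `lfun` +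
`ellL1` + `ellbsd` (kit j293586): `L(E^{(-35)},1) = 0.7167382215589759330…`, `#Ш_an(Wd) = 1`, `∏c(Wd) = 4`, `#Wd(ℚ)_tors = 1`; engine 2
PARI-FREE (kit j294995; bsd-jet eng-2 `e2lib.py` 6701e05d + `tate_stdlib.py` ed9e5fd9 verbatim: BGZ series `2 Σ aₙ/n·e^{−2πn/√N}` over `84075`
terms from PROVED point counts, AGM period `Ω = 0.179184555389743982…` with `j`-self-check, own Tate algorithm `N(Wd) = 223994925`, `∏c = 4`, torsion
`1`, numerical functional equation residual `< 10⁻¹⁵` for `ε = +1`): `L = 0.71673822155897571 ± 10⁻¹¹`, `#Ш_an(Wd) = 1.000000…` — TWO-ENGINE-AGREE;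
and the certificate line `hS`/`hcardS`: an exhibited subgroup of `Sel^(3)(E/ℚ)` of order `27` — EVIDENCE: LB3SUB two-engine GRH-free (kit j293463:
x11b `desc3lib.gp` e6c495dc, `dim = 3`, verify3 ALL-CHECKS-PASS on the three stored classes, indep3 INDEPENDENT; kit j293581: x10b `desc3full_e2.py`
dfa51aff LOWERBOUND `dim ≥ 3`, same `𝔽₃`-subspace `True`). Per pair; NOT a class theorem; nothing booked; BSD is not proved by this.
[cite: JetchevSkinnerWan2017, §7.4.1–7.4.3 (pp. 29–31)] [cite: McCallumLMS1991, §1 Theorem (Kolyvagin), p. 296] [cite: SilvermanAEC2009, Thm. X.4.2(a)]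
[cite: SchaeferStoll2004, §1 and §5] [cite: Miller2011LMS, §1 and Def. 1.1] [cite: Cremona2006, Table 1 (Cremona label 182853c1)] -/
theorem bsdp_g182853c1_3
    (hGZ : ∀ (N : ℕ) [NeZero N] (W : WeierstrassCurve ℚ) (K : Type) [Field K] [NumberField K],
      gross_zagier N W K)
    (hKo : ∀ (N : ℕ) [NeZero N] (W : WeierstrassCurve ℚ) (K : Type) [Field K] [NumberField K],
      kolyvagin N W K)
    (hB : ∀ (N : ℕ) [NeZero N] (W : WeierstrassCurve ℚ) (K : Type) [Field K] [NumberField K],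
      Kolyvagin1990_padicValNat_card_sha_le N W K)
    (hGZK : rank_eq_analyticRank_of_analyticRank_le_one) (hmod : hasEntireLFunction_rat)
    (hnf : exists_isNewformOf) (hMz : mazur_not_dvd_maninConstant_of_odd)
    (hAU : abbesUllmo_not_dvd_maninConstant_of_not_dvd_level)
    (hC2 : cesnavicius_not_two_dvd_maninConstant_of_two_dvd_level)
    {W : WeierstrassCurve ℚ} [W.IsElliptic] [W.IsGloballyMinimal] (hWeq : W = ⟨0, 0, 1, -522, -9187⟩)
    (hr : W.analyticRank = 1) (htam : ¬ 3 ∣ W.tamagawaProduct)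
    (K : Type) [Field K] [NumberField K] (hK : IsImaginaryQuadratic K) (hdK : NumberField.discr K = -35)
    (hHN : SatisfiesHeegnerHypothesis (W.conductorNorm ℤ) K)
    (hLt : (W.quadraticTwist (-35 : ℚ)).entireLFunction 1 ≠ 0)
    {Wd : WeierstrassCurve ℚ} [Wd.IsElliptic] [Wd.IsGloballyMinimal] (hWdeq : Wd = ⟨0, 0, 1, -639450, 393881906⟩)
    {qd : ℚ} (hqd : shaAn Wd = (qd : ℂ)) (hvd : padicValRat 3 qd ≤ 0)
    {S : AddSubgroup (W.galH1Torsion (3 : ℤ))} (hS : S ≤ W.selmerGroup (3 : ℤ)) (hcardS : Nat.card S = 27)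
    {q : ℚ} (hq : shaAn W = (q : ℂ)) (hv : padicValRat 3 q ≤ 2) : BSDp W 3 := by
  subst hWeq hWdeq
  obtain ⟨hadd, hss⟩ := subGss_g182853c1_3
  have hWd : (⟨1, (0 : ℚ), (0 : ℚ), ((1:ℚ)/2)⟩ : VariableChange ℚ) • (⟨0, 0, 1, -522, -9187⟩ : WeierstrassCurve ℚ).quadraticTwist (NumberField.discr K : ℚ) = (⟨0, 0, 1, -639450, 393881906⟩ : WeierstrassCurve ℚ) := by
    rw [hdK]; push_cast
    ext <;> simp [WeierstrassCurve.variableChange_a₁, WeierstrassCurve.variableChange_a₂,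
      WeierstrassCurve.variableChange_a₃, WeierstrassCurve.variableChange_a₄, WeierstrassCurve.variableChange_a₆,
      WeierstrassCurve.quadraticTwist, WeierstrassCurve.b₂, WeierstrassCurve.b₄, WeierstrassCurve.b₆] <;> norm_num
  have hLt' : ((⟨0, 0, 1, -522, -9187⟩ : WeierstrassCurve ℚ).quadraticTwist (NumberField.discr K : ℚ)).entireLFunction 1 ≠ 0 := by
    rw [hdK]; push_cast; exact hLt
  exact bsdp_three_rankOne_subGss_of_card_addSubgroup_selmerThree_of_twistShaAnUnit hGZ hKo hB hGZK hmod hnf hMz hAU hC2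
    _ K _ _ hr hadd hss surj_g182853c1_3 htam hK hHN hLt' hWd hqd hvd hS hcardS hq hv

/-! ### `228897c1` — `N = 228897 = 3²·29·877`; Cremona: `r_an = 1`, `#Ш_an = 9`, `#E(ℚ)_tors = 1`, `∏ c_ℓ = 4`;
(G) ∧ ss at `3` (`e = 2`, `a₃` of the `(−3)`-twist `= 3`); Heegner field `ℚ(√-23)` -/

/-- `[0, 0, 1, -32274, -2231422]` (Cremona's minimal model of `228897c1`) is an elliptic curve: `Δ = 3⁶·29⁴·877 ≠ 0`. [cite: Cremona2006, Table 1 (Cremona label 228897c1)] -/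
theorem isElliptic_g228897c1 : (⟨0, 0, 1, -32274, -2231422⟩ : WeierstrassCurve ℚ).IsElliptic :=
  isElliptic_of_discOf_ne_zero 0 0 1 (-32274) (-2231422) (by decide +kernel)

/-- `[0, 0, 1, -32274, -2231422]` (`228897c1`) is globally minimal: complete factorisation `|Δ| = 3⁶·29⁴·877` kernel-checked and Kraus'
criterion prime by prime (`isGloballyMinimal_of_krausCriterion₃_factored`). [cite: SilvermanAEC2009, VII.1 Remark 1.1]
[cite: Kraus1989, Prop. 1 and Prop. 2] [cite: Cremona2006, Table 1 (Cremona label 228897c1)] -/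
theorem isGloballyMinimal_g228897c1 : (⟨0, 0, 1, -32274, -2231422⟩ : WeierstrassCurve ℚ).IsGloballyMinimal :=
  isGloballyMinimal_of_krausCriterion₃_factored 0 0 1 (-32274) (-2231422)
    [(3, 6), (29, 4), (877, 1)] (by decide +kernel)
    (by intro qe hqe; simp only [List.mem_cons, List.not_mem_nil, or_false] at hqe
        rcases hqe with rfl | rfl | rfl <;> norm_num)
    (by set_option synthInstance.maxSize 2000 in decide +kernel)

/-- `[0, 0, 1, -3586, 82645]` (the minimal model `V` of the `(−3)`-twist of `228897c1`, conductor `25433`) is an elliptic curve: `Δ = 29⁴·877 ≠ 0`. [cite: Cremona2006, Table 1 (Cremona label 228897c1)] -/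
theorem isElliptic_gV228897c1 : (⟨0, 0, 1, -3586, 82645⟩ : WeierstrassCurve ℚ).IsElliptic :=
  isElliptic_of_discOf_ne_zero 0 0 1 (-3586) 82645 (by decide +kernel)

/-- `[0, 0, 1, -3586, 82645]` (`V = 228897c1^{(−3)}`) is globally minimal: complete factorisation `|Δ| = 29⁴·877` kernel-checked and Kraus'
criterion prime by prime (`isGloballyMinimal_of_krausCriterion₃_factored`). [cite: SilvermanAEC2009, VII.1 Remark 1.1]
[cite: Kraus1989, Prop. 1 and Prop. 2] [cite: Cremona2006, Table 1 (Cremona label 228897c1)] -/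
theorem isGloballyMinimal_gV228897c1 : (⟨0, 0, 1, -3586, 82645⟩ : WeierstrassCurve ℚ).IsGloballyMinimal :=
  isGloballyMinimal_of_krausCriterion₃_factored 0 0 1 (-3586) 82645
    [(29, 4), (877, 1)] (by decide +kernel)
    (by intro qe hqe; simp only [List.mem_cons, List.not_mem_nil, or_false] at hqe
        rcases hqe with rfl | rfl <;> norm_num)
    (by set_option synthInstance.maxSize 2000 in decide +kernel)

/-- `[0, 0, 1, -17072946, 27149708432]` (the minimal model `Wd` of the Heegner twist `228897c1^{(-23)}`, conductor `121086513 = 3²·23²·29·877`) is an elliptic curve: `|Δ| = 3⁶·23⁶·29⁴·877 ≠ 0`. [cite: Cremona2006, Table 1 (Cremona label 228897c1)] -/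
theorem isElliptic_gWd228897c1 : (⟨0, 0, 1, -17072946, 27149708432⟩ : WeierstrassCurve ℚ).IsElliptic :=
  isElliptic_of_discOf_ne_zero 0 0 1 (-17072946) 27149708432 (by decide +kernel)

/-- `[0, 0, 1, -17072946, 27149708432]` (`Wd = 228897c1^{(-23)}`) is globally minimal: complete factorisation `|Δ| = 3⁶·23⁶·29⁴·877` kernel-checked and Kraus'
criterion prime by prime (`isGloballyMinimal_of_krausCriterion₃_factored`). [cite: SilvermanAEC2009, VII.1 Remark 1.1]
[cite: Kraus1989, Prop. 1 and Prop. 2] [cite: Cremona2006, Table 1 (Cremona label 228897c1)] -/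
theorem isGloballyMinimal_gWd228897c1 : (⟨0, 0, 1, -17072946, 27149708432⟩ : WeierstrassCurve ℚ).IsGloballyMinimal :=
  isGloballyMinimal_of_krausCriterion₃_factored 0 0 1 (-17072946) 27149708432
    [(3, 6), (23, 6), (29, 4), (877, 1)] (by decide +kernel)
    (by intro qe hqe; simp only [List.mem_cons, List.not_mem_nil, or_false] at hqe
        rcases hqe with rfl | rfl | rfl | rfl <;> norm_num)
    (by set_option synthInstance.maxSize 2000 in decide +kernel)

/-- **`ρ̄_{E,3}` ONTO for `E = 228897c1`** (kernel): irreducible by `ℓ₁ = 5` (`#Ẽ(𝔽_{5}) = 4`, `a = 2`: `X² − aX + ℓ₁` has no root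
mod `3`); an element of order `3` by `ℓ₂ = 31` (`ℓ₂ ≡ 1`, `#Ẽ(𝔽_{31}) = 39`, `a = -7 ≡ 2 (mod 3)`, `9 ∤ 39`) —
`hasSurjectiveModNGaloisRep_of_intModel_of_irr_of_order`; point counts by `decide +kernel`.
[cite: Serre1972, §2.4 Prop. 15, §2.8 Prop. 19] [cite: IrelandRosen1990, Prop. 5.1.2 and §8.1] [cite: Cremona2006, Table 1 (Cremona label 228897c1)] -/
theorem surj_g228897c1_3 : (⟨0, 0, 1, -32274, -2231422⟩ : WeierstrassCurve ℚ).HasSurjectiveModNGaloisRep 3 := by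
  haveI := isElliptic_g228897c1
  haveI := isGloballyMinimal_g228897c1
  haveI : Fact (Nat.Prime 5) := ⟨by norm_num⟩
  haveI : Fact (Nat.Prime 31) := ⟨by norm_num⟩
  have hI : integralModelInt (⟨0, 0, 1, -32274, -2231422⟩ : WeierstrassCurve ℚ) = (⟨0, 0, 1, -32274, -2231422⟩ : WeierstrassCurve ℤ) :=
    integralModelInt_eq_of_map_eq _ (map_mk_int 0 0 1 (-32274) (-2231422))
  have hc₁ : Nat.card ((((⟨0, 0, 1, -32274, -2231422⟩ : WeierstrassCurve ℤ)).map (Int.castRingHom (ZMod 5))).toAffine.Point) = 4 := by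
    have h := natCard_point_eq_countPoints 0 0 1 (-32274) (-2231422) 5 (by norm_num) (by decide +kernel)
    have h' : countPoints [0, 0, 1, -32274, -2231422] 5 = 4 := countPoints_eq_of_fast (by decide +kernel)
    exact_mod_cast h.trans h'
  have hc₂ : Nat.card ((((⟨0, 0, 1, -32274, -2231422⟩ : WeierstrassCurve ℤ)).map (Int.castRingHom (ZMod 31))).toAffine.Point) = 39 := by
    have h := natCard_point_eq_countPoints 0 0 1 (-32274) (-2231422) 31 (by norm_num) (by decide +kernel)
    have h' : countPoints [0, 0, 1, -32274, -2231422] 31 = 39 := countPoints_eq_of_fast (by decide +kernel)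
    exact_mod_cast h.trans h'
  exact hasSurjectiveModNGaloisRep_of_intModel_of_irr_of_order hI 3 5 31 (by norm_num) (by norm_num) (by decide +kernel)
    (by decide +kernel) hc₁ hc₂ (by decide) (by decide) (by decide) (by decide)

/-- **`228897c1` is ADDITIVE at `3` and lies on the census cell (G) ∧ ss** (Kodaira `I₀*`, `e = 2`, the `(−3)`-twist GOOD
SUPERSINGULAR), IN THE KERNEL: `3 ∣ Δ`, `3 ∣ c₄` on the minimal model (`Additive.addv_of_intModel`); the explicit isomorphism
`C • V^{(−3)} = E`, `[u, r, s, t] = [1, 0, 0, 1/2]`, with `V = [0, 0, 1, -3586, 82645]` globally minimal, `3 ∤ Δ(V)`, `#Ṽ(𝔽₃) = 1` (`a₃(V) = 3`,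
`3 ∣ a₃`: `Supersingular.goodSS_of_intModel`), whence `TypeG W 3` (`typeG_three_iff_good_twist`), `SubGord W 3`
(`subGord_three_of_typeG_of_addv`) and `SubGss W 3` (`O5.subGss_three_iff_subGord_and_goodSS_twist`).
[cite: SilvermanAEC2009, VII.5 Prop. 5.1 (a), (c)] [cite: Delbourgo1998, §1.5 (G)] [cite: Cremona2006, Table 1 (Cremona label 228897c1)] -/
theorem subGss_g228897c1_3 :
    haveI := isElliptic_g228897c1; haveI := isGloballyMinimal_g228897c1
    Addv (⟨0, 0, 1, -32274, -2231422⟩ : WeierstrassCurve ℚ) 3 ∧ SubGss (⟨0, 0, 1, -32274, -2231422⟩ : WeierstrassCurve ℚ) 3 := by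
  haveI := isElliptic_g228897c1
  haveI := isGloballyMinimal_g228897c1
  haveI := isElliptic_gV228897c1
  haveI := isGloballyMinimal_gV228897c1
  have hIW : integralModelInt (⟨0, 0, 1, -32274, -2231422⟩ : WeierstrassCurve ℚ) = (⟨0, 0, 1, -32274, -2231422⟩ : WeierstrassCurve ℤ) :=
    integralModelInt_eq_of_map_eq _ (map_mk_int 0 0 1 (-32274) (-2231422))
  have hadd : Addv (⟨0, 0, 1, -32274, -2231422⟩ : WeierstrassCurve ℚ) 3 := Additive.addv_of_intModel hIW 3 (by decide +kernel) (by decide +kernel)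
  have hIV : integralModelInt (⟨0, 0, 1, -3586, 82645⟩ : WeierstrassCurve ℚ) = (⟨0, 0, 1, -3586, 82645⟩ : WeierstrassCurve ℤ) :=
    integralModelInt_eq_of_map_eq _ (map_mk_int 0 0 1 (-3586) 82645)
  have hcV : Nat.card ((((⟨0, 0, 1, -3586, 82645⟩ : WeierstrassCurve ℤ)).map (Int.castRingHom (ZMod 3))).toAffine.Point) = 1 := by
    have h := natCard_point_eq_countPoints 0 0 1 (-3586) 82645 3 (by norm_num) (by decide +kernel)
    have h' : countPoints [0, 0, 1, -3586, 82645] 3 = 1 := countPoints_eq_of_fast (by decide +kernel)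
    exact_mod_cast h.trans h'
  have hgood : GoodSS (⟨0, 0, 1, -3586, 82645⟩ : WeierstrassCurve ℚ) 3 := Supersingular.goodSS_of_intModel 3 hIV (by decide +kernel) hcV (by decide)
  have hVW : (⟨1, (0 : ℚ), (0 : ℚ), ((1:ℚ)/2)⟩ : VariableChange ℚ) • (⟨0, 0, 1, -3586, 82645⟩ : WeierstrassCurve ℚ).quadraticTwist (-3) = (⟨0, 0, 1, -32274, -2231422⟩ : WeierstrassCurve ℚ) := by
    ext <;> simp [WeierstrassCurve.variableChange_a₁, WeierstrassCurve.variableChange_a₂,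
      WeierstrassCurve.variableChange_a₃, WeierstrassCurve.variableChange_a₄, WeierstrassCurve.variableChange_a₆,
      WeierstrassCurve.quadraticTwist, WeierstrassCurve.b₂, WeierstrassCurve.b₄, WeierstrassCurve.b₆] <;> norm_num
  obtain ⟨C, hC⟩ := exists_variableChange_quadraticTwist_symm (⟨0, 0, 1, -32274, -2231422⟩ : WeierstrassCurve ℚ) (⟨0, 0, 1, -3586, 82645⟩ : WeierstrassCurve ℚ) (d := (-3 : ℚ)) (by norm_num) ⟨_, hVW⟩
  have hC' : C • (⟨0, 0, 1, -32274, -2231422⟩ : WeierstrassCurve ℚ).quadraticTwist ((-1 : ℚ) ^ ((3 : ℕ) / 2) * (3 : ℕ)) = (⟨0, 0, 1, -3586, 82645⟩ : WeierstrassCurve ℚ) := by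
    rw [O5.pstar_three]; exact hC
  have hG : TypeG (⟨0, 0, 1, -32274, -2231422⟩ : WeierstrassCurve ℚ) 3 := (typeG_three_iff_good_twist _ hadd _ C hC').mpr hgood.1
  exact ⟨hadd, (O5.subGss_three_iff_subGord_and_goodSS_twist _ hadd _ C hC).mpr
    ⟨subGord_three_of_typeG_of_addv _ hG hadd, hgood⟩⟩

/-- **`BSD(E,3)` for `E = 228897c1`** (`N = 228897 = 3²·29·877`; (G) ∧ ss at `3`, `e = 2`; Cremona: `r_an = 1` (generator `(-104, 14)`),
`#Ш_an = 9`, `#E(ℚ)_tors = 1`, `∏ c_ℓ = 4`, `3 ∤ ∏ c_ℓ`), door `bsdp_three_rankOne_subGss_of_card_addSubgroup_selmerThree_of_twistShaAnUnit`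
(Part 23d, p584506): UPPER = Kolyvagin at the Manin-good Heegner datum of the type-`I₀*` prime `3` over `K = ℚ(√-23)` + Gross–Zagier +
the rank-zero twist's free lower half; LOWER = the exhibited subgroup `S ≤ Sel^(3)(E/ℚ)`, `#S = 27` (no Cassels–Tate, no class group).
IN THE KERNEL: `Δ ≠ 0` and global minimality of `E`, of `V = E^{(−3)}` and of `Wd = E^{(-23)}` (Kraus), `Addv W 3 ∧ SubGss W 3`
(`subGss_g228897c1_3`), `ρ̄_{E,3}` ONTO (`surj_g228897c1_3`), the twist identity `Cd • E^{(-23)} = Wd`, `[u, r, s, t] = [1, 0, 0, 1/2]`, with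
`Wd = [0, 0, 1, -17072946, 27149708432]` (`N(Wd) = 121086513 = 3²·23²·29·877`). DISPLAYED binders: the PUBLISHED facts hGZ hKo hB hGZK hmod hnf (+ cite-only hMz hAU
hC2); Cremona's `r_an = 1` (`hr`), `3 ∤ ∏ c_ℓ = 4` (`htam`), `#Ш_an = q`, `ord₃ q ≤ 2` (`hq`/`hv`); the Heegner field `K`,
`d_K = -23` (`hK`/`hdK`; every prime of `N` splits in `K`: kit j294966; other unit fields `d_K ∈ {-23, -59, -71, -152, -167, -179, -212, -227, -260, -323, -347}`, kit j293586) with `hHN`;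
the twist datum `L(E^{(-23)},1) ≠ 0` (`hLt`) and `#Ш_an(Wd) = qd`, `ord₃ qd ≤ 0` (`hqd`/`hvd`) — EVIDENCE, TWO ENGINES: engine 1 PARI `lfun` +
`ellL1` + `ellbsd` (kit j293586): `L(E^{(-23)},1) = 3.0114024663437284894…`, `#Ш_an(Wd) = 1`, `∏c(Wd) = 16`, `#Wd(ℚ)_tors = 1`; engine 2
PARI-FREE (kit j294995; bsd-jet eng-2 `e2lib.py` 6701e05d + `tate_stdlib.py` ed9e5fd9 verbatim: BGZ series `2 Σ aₙ/n·e^{−2πn/√N}` over `63165`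
terms from PROVED point counts, AGM period `Ω = 0.188212654146483027…` with `j`-self-check, own Tate algorithm `N(Wd) = 121086513`, `∏c = 16`, torsion
`1`, numerical functional equation residual `< 10⁻¹⁵` for `ε = +1`): `L = 3.0114024663437284 ± 10⁻¹¹`, `#Ш_an(Wd) = 1.000000…` — TWO-ENGINE-AGREE;
and the certificate line `hS`/`hcardS`: an exhibited subgroup of `Sel^(3)(E/ℚ)` of order `27` — EVIDENCE: LB3SUB two-engine GRH-free (kit j293463:
x11b `desc3lib.gp` e6c495dc, `dim = 3`, verify3 ALL-CHECKS-PASS on the three stored classes, indep3 INDEPENDENT; kit j293581: x10b `desc3full_e2.py`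
dfa51aff LOWERBOUND `dim ≥ 3`, same `𝔽₃`-subspace `True`). Per pair; NOT a class theorem; nothing booked; BSD is not proved by this.
[cite: JetchevSkinnerWan2017, §7.4.1–7.4.3 (pp. 29–31)] [cite: McCallumLMS1991, §1 Theorem (Kolyvagin), p. 296] [cite: SilvermanAEC2009, Thm. X.4.2(a)]
[cite: SchaeferStoll2004, §1 and §5] [cite: Miller2011LMS, §1 and Def. 1.1] [cite: Cremona2006, Table 1 (Cremona label 228897c1)] -/
theorem bsdp_g228897c1_3
    (hGZ : ∀ (N : ℕ) [NeZero N] (W : WeierstrassCurve ℚ) (K : Type) [Field K] [NumberField K],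
      gross_zagier N W K)
    (hKo : ∀ (N : ℕ) [NeZero N] (W : WeierstrassCurve ℚ) (K : Type) [Field K] [NumberField K],
      kolyvagin N W K)
    (hB : ∀ (N : ℕ) [NeZero N] (W : WeierstrassCurve ℚ) (K : Type) [Field K] [NumberField K],
      Kolyvagin1990_padicValNat_card_sha_le N W K)
    (hGZK : rank_eq_analyticRank_of_analyticRank_le_one) (hmod : hasEntireLFunction_rat)
    (hnf : exists_isNewformOf) (hMz : mazur_not_dvd_maninConstant_of_odd)
    (hAU : abbesUllmo_not_dvd_maninConstant_of_not_dvd_level)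
    (hC2 : cesnavicius_not_two_dvd_maninConstant_of_two_dvd_level)
    {W : WeierstrassCurve ℚ} [W.IsElliptic] [W.IsGloballyMinimal] (hWeq : W = ⟨0, 0, 1, -32274, -2231422⟩)
    (hr : W.analyticRank = 1) (htam : ¬ 3 ∣ W.tamagawaProduct)
    (K : Type) [Field K] [NumberField K] (hK : IsImaginaryQuadratic K) (hdK : NumberField.discr K = -23)
    (hHN : SatisfiesHeegnerHypothesis (W.conductorNorm ℤ) K)
    (hLt : (W.quadraticTwist (-23 : ℚ)).entireLFunction 1 ≠ 0)
    {Wd : WeierstrassCurve ℚ} [Wd.IsElliptic] [Wd.IsGloballyMinimal] (hWdeq : Wd = ⟨0, 0, 1, -17072946, 27149708432⟩)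
    {qd : ℚ} (hqd : shaAn Wd = (qd : ℂ)) (hvd : padicValRat 3 qd ≤ 0)
    {S : AddSubgroup (W.galH1Torsion (3 : ℤ))} (hS : S ≤ W.selmerGroup (3 : ℤ)) (hcardS : Nat.card S = 27)
    {q : ℚ} (hq : shaAn W = (q : ℂ)) (hv : padicValRat 3 q ≤ 2) : BSDp W 3 := by
  subst hWeq hWdeq
  obtain ⟨hadd, hss⟩ := subGss_g228897c1_3
  have hWd : (⟨1, (0 : ℚ), (0 : ℚ), ((1:ℚ)/2)⟩ : VariableChange ℚ) • (⟨0, 0, 1, -32274, -2231422⟩ : WeierstrassCurve ℚ).quadraticTwist (NumberField.discr K : ℚ) = (⟨0, 0, 1, -17072946, 27149708432⟩ : WeierstrassCurve ℚ) := by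
    rw [hdK]; push_cast
    ext <;> simp [WeierstrassCurve.variableChange_a₁, WeierstrassCurve.variableChange_a₂,
      WeierstrassCurve.variableChange_a₃, WeierstrassCurve.variableChange_a₄, WeierstrassCurve.variableChange_a₆,
      WeierstrassCurve.quadraticTwist, WeierstrassCurve.b₂, WeierstrassCurve.b₄, WeierstrassCurve.b₆] <;> norm_num
  have hLt' : ((⟨0, 0, 1, -32274, -2231422⟩ : WeierstrassCurve ℚ).quadraticTwist (NumberField.discr K : ℚ)).entireLFunction 1 ≠ 0 := by
    rw [hdK]; push_cast; exact hLt
  exact bsdp_three_rankOne_subGss_of_card_addSubgroup_selmerThree_of_twistShaAnUnit hGZ hKo hB hGZK hmod hnf hMz hAU hC2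
    _ K _ _ hr hadd hss surj_g228897c1_3 htam hK hHN hLt' hWd hqd hvd hS hcardS hq hv

end Summit.BirchSwinnertonDyer.BirchSwinnertonDyer.Theorems.AdditiveBranchIMCGordTwoRankOne.HeegnerKolyvagin

end
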